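import Literature.NumberTheory.Rogawski1990.ExplicitFactorContinuousAtMatchingPair     -- ★ F4 p835442: `continuousWithinAt_archExplicitDelta_of_forall_archKappaAt_ne_zero` (+ F3B, F3A)
import Literature.NumberTheory.Rogawski1990.ArchExplicitTransferFactorScalarPartner      -- ★ D-S2∞ p836443: the values at the scalar partner
import Literature.NumberTheory.Rogawski1990.ArchExplicitTransferFactorGHRegular          -- ★ p835385 (p08): `archKappaAt_ne_zero_of_evalC_ne_zero`, `archExplicitDelta_ne_zero_of_isUnit_eval`
import HarnessLib

/-!
# Rogawski's archimedean explicit factor ALONG A CURVE OF MATCHING PAIRS through a `(G,H)`-regular point: `Δ″_∞`, `τ_∞`, `D_{G∕H,∞}` are continuous and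
# non-zero there and `Π_w κ_w` has NO jump (Rogawski (1990) §8.2 pp. 122–123, §14.6 p. 242)

Topic `NumberTheory/Rogawski1990`; namespace `Literature.NumberTheory.Rogawski1990`.  THEOREMS ONLY (no definition, no named fact, no instance, no notation,
no `sorry`; net debt 0).  Cell `pub/hodgecm-mathlib`, F0∕P3a, topic T6 (#88 side; road letter «D-S2∞-curve′», LEAD F0P3a-plan (g8) T7-5 (8) as corrected by the
census `F0/P3a/F0P3a-p05/g10/CENSUS-DS2inf-curve.F0P3a-p05g10.md`): the transfer-factor half of the (L-jump) letter along print's curve `γ(θ, φ, ψ)` through the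
split-singular `γ₀ = γ(θ, φ, 0)`.  Mathlib-only footing; count-neutral for the books.

THE MATHEMATICS (print §8.2 p. 122–123).  Along `γ(ψ) = γ(θ,φ,ψ)` (eigenvalues `e^{i(θ±ψ)}, e^{iφ}`, `e^{iθ} ≠ e^{iφ}`) the `H`-side point is `γ_H(ψ) = (g(ψ), u)` with
`g(ψ)` carrying the COALESCING pair `e^{i(θ±ψ)}` and `u = e^{iφ}` fixed; the pair `(γ_H(0), γ₀)` is `(G,H)`-REGULAR (`u ∉ spec g(0)`), so near `ψ = 0`:
`D_{G∕H,∞} = Π_w|(u − γ₁)(u − γ₃)|_w → |e^{iφ} − e^{iθ}|² ≠ 0`, `τ_∞(γ(ψ)) = μ(e^{iφ})μ⁻¹((e^{i(φ−θ−ψ)} − 1)(1 − e^{i(φ−θ+ψ)}))` (p. 123) is continuous and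
non-zero, every `κ_w` is LOCALLY CONSTANT through `ψ = 0` (no jump — print's `±1` are the Kottwitz signs of the two limit classes `γ₀`, `γ₀′`), hence `Δ″_∞` is
continuous and non-zero through `ψ = 0`; the factor `|2 sin ψ| = D_H(γ(ψ))` of p. 123 normalises `Φ_H`, it is not part of `Δ`.  We prove this for ANY family
`γc : X → H_∞ × G′_∞` of matching pairs continuous at `x₀` with `(G,H)`-regular value there (the lift of ★ `ArchTorusOneAngleCurve`'s split curve into
`U(Φ₂) × U(Φ₁)` and `U(H′)` over `L ⊗ ℝ` then specialises it by composition), and identify the limits at a scalar `H`-block `g(x₀) = e·1₂` with the closed forms of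
★ D-S2∞ `ArchExplicitTransferFactorScalarPartner`.

* §1 `eventually_isUnit_eval_archCharpolyTwo_comp` (`(G,H)`-regularity is open along the family), `continuousAt_archWeylRatio_comp`, `eventually_archWeylRatio_comp_ne_zero`,
  `continuousAt_archTau_comp`, `eventually_archTau_comp_ne_zero`.
* §2 **`eventually_archKappaAt_comp_eq`**, **`eventually_prod_archKappaAt_comp_eq`** (no jump of `κ`), `…_of_isUnit_eval` (the `κ ≠ 0` guard discharged from `hherm`,
  `hanis`, ★ `archKappaAt_ne_zero_of_evalC_ne_zero`).
* §3 **`continuousAt_archExplicitDelta_comp`**, `continuousAt_archCanonicalDelta_comp`, **`continuousAt_archExplicitDelta_comp_of_isUnit_eval`**,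
  `continuousAt_archCanonicalDelta_comp_of_isUnit_eval`, **`eventually_archExplicitDelta_comp_ne_zero`**, `eventually_archCanonicalDelta_comp_ne_zero`.
* §4 (scalar `H`-block at `x₀`) **`tendsto_archWeylRatio_comp_of_fst_eq_smul_one`** (`→ Π_w ‖σ_w(u − e)‖²`), `tendsto_archTau_comp_of_fst_eq_smul_one`,
  **`tendsto_archExplicitDelta_comp_of_fst_eq_smul_one`**.

HONEST LABEL: HC_CM is proved only modulo the printed citations (named inputs remaining 2) until rung 0 closes; this file proves none of them.

## References
* [Rogawski1990] J. D. Rogawski, *Automorphic Representations of Unitary Groups in Three Variables*, Ann. of Math. Stud. 123 (1990): §8.2 Prop. 8.2.1 and pp. 122–123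
  (the curve `γ(θ,φ,ψ)`, `γ₀`, `D_H = |2 sin ψ|`, the display for `τ(γ)|A₁A₂|`), §4.9 pp. 54–55, §14.6 p. 242.
* [Shelstad1979] D. Shelstad, *Characters and inner forms of a quasi-split group over `ℝ`*, Compositio Math. 39 (1979), §4.
-/

set_option autoImplicit false

noncomputable section

open NumberField InfinitePlace IsDedekindDomain Matrix Polynomial Filter Topology
open scoped MatrixGroups

namespace Literature.NumberTheory.Rogawski1990

open Literature.NumberTheory.Automorphic
open Literature.NumberTheory.GaloisRepresentations
open Literature.AlgebraicGeometry.ShimuraVarieties (hermForm)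

variable (L : Type) [Field L] [NumberField L] [IsCMField L] (H' : Matrix (Fin 3) (Fin 3) L)
  {X : Type*} [TopologicalSpace X]
  (γc : X →
    (↥(UnitaryGroup.arch (↥(maximalRealSubfield L)) L (IsCMField.complexConj L) 2
        (Matrix.of fun i j : Fin 2 => if i.val + j.val + 1 = 2 then (1 : L) else 0)) ×
      ↥(UnitaryGroup.arch (↥(maximalRealSubfield L)) L (IsCMField.complexConj L) 1
        (Matrix.of fun i j : Fin 1 => if i.val + j.val + 1 = 1 then (1 : L) else 0))) ×
    ↥(UnitaryGroup.arch (↥(maximalRealSubfield L)) L (IsCMField.complexConj L) 3 H'))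
  {x₀ : X} (hc : ContinuousAt γc x₀)

/-! ## §1 `(G,H)`-regularity is open along the family; `D_{G∕H,∞}` and `τ_∞` are continuous and non-zero at `x₀` -/

include hc in
/-- **`(G,H)`-regularity persists near `x₀`**: `χ_{g(x)}(u(x)) ∈ (L ⊗ ℝ)ˣ` for `x` near `x₀` (units are open, ★ `isOpen_setOf_isUnit_mixedSpace`; `q ↦ χ_g(u)` is continuous,
★ `continuous_eval_archCharpolyTwo`). [cite: Rogawski1990, §8.2 p. 122] -/
theorem eventually_isUnit_eval_archCharpolyTwo_comp (hu : IsUnit ((archCharpolyTwo L (γc x₀).1).eval (archGammaTwo L (γc x₀).1))) :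
    ∀ᶠ x in 𝓝 x₀, IsUnit ((archCharpolyTwo L (γc x).1).eval (archGammaTwo L (γc x).1)) := by
  have hcont : ContinuousAt (fun x => (archCharpolyTwo L (γc x).1).eval (archGammaTwo L (γc x).1)) x₀ :=
    ContinuousAt.comp (f := fun x => (γc x).1) (g := fun a => (archCharpolyTwo L a).eval (archGammaTwo L a))
      (continuous_eval_archCharpolyTwo L).continuousAt hc.fst
  exact hcont.eventually ((isOpen_setOf_isUnit_mixedSpace L).mem_nhds hu)

include hc in
/-- `x ↦ D_{G∕H,∞}(γ_H(x))` is continuous at `x₀` (★ `continuous_archWeylRatio`). [cite: Rogawski1990, §4.9 p. 55] -/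
theorem continuousAt_archWeylRatio_comp : ContinuousAt (fun x => archWeylRatio L (γc x).1) x₀ :=
  ContinuousAt.comp (f := fun x => (γc x).1) (g := fun a => archWeylRatio L a) (continuous_archWeylRatio L).continuousAt hc.fst

include hc in
/-- `D_{G∕H,∞}(γ_H(x)) ≠ 0` near `x₀` (★ `archWeylRatio_ne_zero_of_isUnit_eval`). [cite: Rogawski1990, §8.2 p. 122; §4.9 p. 55] -/
theorem eventually_archWeylRatio_comp_ne_zero (hu : IsUnit ((archCharpolyTwo L (γc x₀).1).eval (archGammaTwo L (γc x₀).1))) :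
    ∀ᶠ x in 𝓝 x₀, archWeylRatio L (γc x).1 ≠ 0 :=
  (eventually_isUnit_eval_archCharpolyTwo_comp L H' γc hc hu).mono fun _ hx => archWeylRatio_ne_zero_of_isUnit_eval L _ hx

include hc in
/-- **`x ↦ τ_∞(γ_H(x))` is continuous at `x₀`** (★ F3A `continuousOn_archTau` on the open `(G,H)`-regular set). [cite: Rogawski1990, §8.2 p. 123; §4.9 p. 55] -/
theorem continuousAt_archTau_comp (μ : HeckeCharacter L) (hu : IsUnit ((archCharpolyTwo L (γc x₀).1).eval (archGammaTwo L (γc x₀).1))) :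
    ContinuousAt (fun x => archTau L (γc x).1 μ) x₀ := by
  have hopen : IsOpen {a : ↥(UnitaryGroup.arch (↥(maximalRealSubfield L)) L (IsCMField.complexConj L) 2
          (Matrix.of fun i j : Fin 2 => if i.val + j.val + 1 = 2 then (1 : L) else 0)) ×
        ↥(UnitaryGroup.arch (↥(maximalRealSubfield L)) L (IsCMField.complexConj L) 1
          (Matrix.of fun i j : Fin 1 => if i.val + j.val + 1 = 1 then (1 : L) else 0)) |
        IsUnit ((archCharpolyTwo L a).eval (archGammaTwo L a))} :=
    (isOpen_setOf_isUnit_mixedSpace L).preimage (continuous_eval_archCharpolyTwo L)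
  exact ContinuousAt.comp (f := fun x => (γc x).1) (g := fun a => archTau L a μ) ((continuousOn_archTau L μ).continuousAt (hopen.mem_nhds hu)) hc.fst

include hc in
/-- `τ_∞(γ_H(x)) ≠ 0` near `x₀` (★ `archTau_ne_zero_of_isUnit_eval`). [cite: Rogawski1990, §8.2 p. 123] -/
theorem eventually_archTau_comp_ne_zero (μ : HeckeCharacter L) (hu : IsUnit ((archCharpolyTwo L (γc x₀).1).eval (archGammaTwo L (γc x₀).1))) :
    ∀ᶠ x in 𝓝 x₀, archTau L (γc x).1 μ ≠ 0 :=
  (eventually_isUnit_eval_archCharpolyTwo_comp L H' γc hc hu).mono fun _ hx => archTau_ne_zero_of_isUnit_eval L _ μ hx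

/-! ## §2 No jump of `κ_w` through a `(G,H)`-regular point -/

include hc in
/-- **`κ_w(γ_H(x), γ′(x)) = κ_w(γ_H(x₀), γ′(x₀))` for `x` near `x₀`** whenever `κ_w ≠ 0` at `x₀` (★ F3B `archKappaAt_eventually_eq_of_ne_zero` pulled back along the
family): NO JUMP of the archimedean sign through print's `γ₀`. [cite: Rogawski1990, §8.2 p. 122; §14.6 p. 242] -/
theorem eventually_archKappaAt_comp_eq (w : {w : InfinitePlace L // IsComplex w}) (hκ : archKappaAt L H' (γc x₀).1 w (γc x₀).2 ≠ 0) :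
    ∀ᶠ x in 𝓝 x₀, archKappaAt L H' (γc x).1 w (γc x).2 = archKappaAt L H' (γc x₀).1 w (γc x₀).2 := by
  have h : ∀ᶠ q in 𝓝 (γc x₀), archKappaAt L H' q.1 w q.2 = archKappaAt L H' (γc x₀).1 w (γc x₀).2 := by
    simpa only [Prod.mk.eta] using archKappaAt_eventually_eq_of_ne_zero L H' w hκ
  exact hc.tendsto.eventually h

include hc in
open scoped Classical in
/-- **`Π_w κ_w` is constant near `x₀`** along the family (all `κ_w ≠ 0` at `x₀`). [cite: Rogawski1990, §8.2 p. 122; §14.6 p. 242] -/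
theorem eventually_prod_archKappaAt_comp_eq (hκ : ∀ w : {w : InfinitePlace L // IsComplex w}, archKappaAt L H' (γc x₀).1 w (γc x₀).2 ≠ 0) :
    ∀ᶠ x in 𝓝 x₀,
      (∏ w : {w : InfinitePlace L // IsComplex w}, archKappaAt L H' (γc x).1 w (γc x).2) =
        ∏ w : {w : InfinitePlace L // IsComplex w}, archKappaAt L H' (γc x₀).1 w (γc x₀).2 := by
  have h : ∀ᶠ q in 𝓝 (γc x₀),
      (∏ w : {w : InfinitePlace L // IsComplex w}, archKappaAt L H' q.1 w q.2) =
        ∏ w : {w : InfinitePlace L // IsComplex w}, archKappaAt L H' (γc x₀).1 w (γc x₀).2 := by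
    simpa only [Prod.mk.eta] using prod_archKappaAt_eventually_eq_of_forall_ne_zero L H' hκ
  exact hc.tendsto.eventually h

include hc in
open scoped Classical in
/-- **`Π_w κ_w` is constant near `x₀`** along a MATCHING family through a `(G,H)`-regular pair, for `c`-hermitian anisotropic `H′` (the guard `κ_w ≠ 0` discharged by
★ `archKappaAt_ne_zero_of_evalC_ne_zero`). [cite: Rogawski1990, §8.2 p. 122; §14.6 p. 242] -/
theorem eventually_prod_archKappaAt_comp_eq_of_isUnit_eval (hherm : (H'.map (cmConjRingHom L)).transpose = H')
    (hanis : ∀ x : Fin 3 → L, hermForm (cmConjRingHom L) H' x x = 0 → x = 0) (hm : IsArchNormPair L H' (γc x₀).1 (γc x₀).2)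
    (hu : IsUnit ((archCharpolyTwo L (γc x₀).1).eval (archGammaTwo L (γc x₀).1))) :
    ∀ᶠ x in 𝓝 x₀,
      (∏ w : {w : InfinitePlace L // IsComplex w}, archKappaAt L H' (γc x).1 w (γc x).2) =
        ∏ w : {w : InfinitePlace L // IsComplex w}, archKappaAt L H' (γc x₀).1 w (γc x₀).2 :=
  eventually_prod_archKappaAt_comp_eq L H' γc hc fun w =>
    archKappaAt_ne_zero_of_evalC_ne_zero L H' _ _ w hherm hanis hm (hu.map (UnitaryGroup.evalC L w)).ne_zero

/-! ## §3 `Δ″_∞` and `Δ‴_∞` are continuous and non-zero along the family at `x₀` -/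

include hc in
open scoped Classical in
/-- **`x ↦ Δ″_∞(γ_H(x), γ′(x))` IS CONTINUOUS AT `x₀`** along a family of MATCHING pairs, `(G,H)`-regular with all `κ_w ≠ 0` at `x₀` (★ F4
`continuousWithinAt_archExplicitDelta_of_forall_archKappaAt_ne_zero` composed with the family). [cite: Rogawski1990, §8.2 pp. 122–123; §14.6 p. 242] -/
theorem continuousAt_archExplicitDelta_comp (μ : HeckeCharacter L) (hm : ∀ x, IsArchNormPair L H' (γc x).1 (γc x).2)
    (hu : IsUnit ((archCharpolyTwo L (γc x₀).1).eval (archGammaTwo L (γc x₀).1)))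
    (hκ : ∀ w : {w : InfinitePlace L // IsComplex w}, archKappaAt L H' (γc x₀).1 w (γc x₀).2 ≠ 0) :
    ContinuousAt (fun x => archExplicitDelta L H' (γc x).1 μ (γc x).2) x₀ := by
  have h : ContinuousWithinAt
      (fun q : (↥(UnitaryGroup.arch (↥(maximalRealSubfield L)) L (IsCMField.complexConj L) 2
          (Matrix.of fun i j : Fin 2 => if i.val + j.val + 1 = 2 then (1 : L) else 0)) ×
        ↥(UnitaryGroup.arch (↥(maximalRealSubfield L)) L (IsCMField.complexConj L) 1
          (Matrix.of fun i j : Fin 1 => if i.val + j.val + 1 = 1 then (1 : L) else 0))) ×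
        ↥(UnitaryGroup.arch (↥(maximalRealSubfield L)) L (IsCMField.complexConj L) 3 H') => archExplicitDelta L H' q.1 μ q.2)
      {q | IsArchNormPair L H' q.1 q.2} (γc x₀) := by
    simpa only [Prod.mk.eta] using continuousWithinAt_archExplicitDelta_of_forall_archKappaAt_ne_zero L H' μ (hm x₀) hu hκ
  have := ContinuousWithinAt.comp (f := γc) (s := Set.univ) h hc.continuousWithinAt fun x _ => hm x
  exact (continuousWithinAt_univ _ _).1 this

include hc in
open scoped Classical in
/-- **`x ↦ Δ‴_∞(γ_H(x), γ′(x))` is continuous at `x₀`** (the ray, ★ F4 `continuousWithinAt_archCanonicalDelta_of_forall_archKappaAt_ne_zero`).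
[cite: Rogawski1990, §8.2 pp. 122–123; §14.6 p. 242] [cite: LanglandsShelstad1987, §4.2] -/
theorem continuousAt_archCanonicalDelta_comp (μ : HeckeCharacter L) (hm : ∀ x, IsArchNormPair L H' (γc x).1 (γc x).2)
    (hu : IsUnit ((archCharpolyTwo L (γc x₀).1).eval (archGammaTwo L (γc x₀).1)))
    (hκ : ∀ w : {w : InfinitePlace L // IsComplex w}, archKappaAt L H' (γc x₀).1 w (γc x₀).2 ≠ 0) :
    ContinuousAt (fun x => archCanonicalDelta L H' (γc x).1 μ (γc x).2) x₀ := by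
  have h : ContinuousWithinAt
      (fun q : (↥(UnitaryGroup.arch (↥(maximalRealSubfield L)) L (IsCMField.complexConj L) 2
          (Matrix.of fun i j : Fin 2 => if i.val + j.val + 1 = 2 then (1 : L) else 0)) ×
        ↥(UnitaryGroup.arch (↥(maximalRealSubfield L)) L (IsCMField.complexConj L) 1
          (Matrix.of fun i j : Fin 1 => if i.val + j.val + 1 = 1 then (1 : L) else 0))) ×
        ↥(UnitaryGroup.arch (↥(maximalRealSubfield L)) L (IsCMField.complexConj L) 3 H') => archCanonicalDelta L H' q.1 μ q.2)
      {q | IsArchNormPair L H' q.1 q.2} (γc x₀) := by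
    simpa only [Prod.mk.eta] using continuousWithinAt_archCanonicalDelta_of_forall_archKappaAt_ne_zero L H' μ (hm x₀) hu hκ
  have := ContinuousWithinAt.comp (f := γc) (s := Set.univ) h hc.continuousWithinAt fun x _ => hm x
  exact (continuousWithinAt_univ _ _).1 this

include hc in
open scoped Classical in
/-- **`Δ″_∞` along the family is continuous at `x₀`** — `c`-hermitian anisotropic `H′`, matching family, `(G,H)`-regular at `x₀` (guards discharged).
[cite: Rogawski1990, §8.2 pp. 122–123; §14.6 p. 242] -/
theorem continuousAt_archExplicitDelta_comp_of_isUnit_eval (μ : HeckeCharacter L) (hherm : (H'.map (cmConjRingHom L)).transpose = H')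
    (hanis : ∀ x : Fin 3 → L, hermForm (cmConjRingHom L) H' x x = 0 → x = 0) (hm : ∀ x, IsArchNormPair L H' (γc x).1 (γc x).2)
    (hu : IsUnit ((archCharpolyTwo L (γc x₀).1).eval (archGammaTwo L (γc x₀).1))) :
    ContinuousAt (fun x => archExplicitDelta L H' (γc x).1 μ (γc x).2) x₀ :=
  continuousAt_archExplicitDelta_comp L H' γc hc μ hm hu fun w =>
    archKappaAt_ne_zero_of_evalC_ne_zero L H' _ _ w hherm hanis (hm x₀) (hu.map (UnitaryGroup.evalC L w)).ne_zero

include hc in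
open scoped Classical in
/-- **`Δ‴_∞` along the family is continuous at `x₀`** (guards discharged). [cite: Rogawski1990, §8.2 pp. 122–123; §14.6 p. 242] -/
theorem continuousAt_archCanonicalDelta_comp_of_isUnit_eval (μ : HeckeCharacter L) (hherm : (H'.map (cmConjRingHom L)).transpose = H')
    (hanis : ∀ x : Fin 3 → L, hermForm (cmConjRingHom L) H' x x = 0 → x = 0) (hm : ∀ x, IsArchNormPair L H' (γc x).1 (γc x).2)
    (hu : IsUnit ((archCharpolyTwo L (γc x₀).1).eval (archGammaTwo L (γc x₀).1))) :
    ContinuousAt (fun x => archCanonicalDelta L H' (γc x).1 μ (γc x).2) x₀ :=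
  continuousAt_archCanonicalDelta_comp L H' γc hc μ hm hu fun w =>
    archKappaAt_ne_zero_of_evalC_ne_zero L H' _ _ w hherm hanis (hm x₀) (hu.map (UnitaryGroup.evalC L w)).ne_zero

include hc in
/-- **`Δ″_∞(γ_H(x), γ′(x)) ≠ 0` for `x` near `x₀`** (★ `archExplicitDelta_ne_zero_of_isUnit_eval` at every nearby `(G,H)`-regular matching pair).
[cite: Rogawski1990, §8.2 Prop. 8.2.1 p. 117 and pp. 122–123] -/
theorem eventually_archExplicitDelta_comp_ne_zero (μ : HeckeCharacter L) (hherm : (H'.map (cmConjRingHom L)).transpose = H')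
    (hanis : ∀ x : Fin 3 → L, hermForm (cmConjRingHom L) H' x x = 0 → x = 0) (hm : ∀ x, IsArchNormPair L H' (γc x).1 (γc x).2)
    (hu : IsUnit ((archCharpolyTwo L (γc x₀).1).eval (archGammaTwo L (γc x₀).1))) :
    ∀ᶠ x in 𝓝 x₀, archExplicitDelta L H' (γc x).1 μ (γc x).2 ≠ 0 :=
  (eventually_isUnit_eval_archCharpolyTwo_comp L H' γc hc hu).mono fun x hx =>
    archExplicitDelta_ne_zero_of_isUnit_eval L H' _ _ μ hherm hanis (hm x) hx

include hc in
/-- **`Δ‴_∞(γ_H(x), γ′(x)) ≠ 0` for `x` near `x₀`** (★ `archCanonicalDelta_ne_zero_of_isUnit_eval`). [cite: Rogawski1990, §8.2 pp. 122–123; §14.6 p. 242] -/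
theorem eventually_archCanonicalDelta_comp_ne_zero (μ : HeckeCharacter L) (hherm : (H'.map (cmConjRingHom L)).transpose = H')
    (hanis : ∀ x : Fin 3 → L, hermForm (cmConjRingHom L) H' x x = 0 → x = 0) (hm : ∀ x, IsArchNormPair L H' (γc x).1 (γc x).2)
    (hu : IsUnit ((archCharpolyTwo L (γc x₀).1).eval (archGammaTwo L (γc x₀).1))) :
    ∀ᶠ x in 𝓝 x₀, archCanonicalDelta L H' (γc x).1 μ (γc x).2 ≠ 0 :=
  (eventually_isUnit_eval_archCharpolyTwo_comp L H' γc hc hu).mono fun x hx =>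
    archCanonicalDelta_ne_zero_of_isUnit_eval L H' _ _ μ hherm hanis (hm x) hx

/-! ## §4 The limits at a scalar `H`-block `g(x₀) = e·1₂` are the closed forms of ★ D-S2∞ -/

include hc in
open scoped Classical in
/-- **`D_{G∕H,∞}(γ_H(x)) → Π_w ‖σ_w(u − e)‖²` as `x → x₀`** when `g(x₀) = e·1₂` (print's `γ₀`: `→ |e^{iφ} − e^{iθ}|²` per place — NOT `0`).
[cite: Rogawski1990, §8.2 pp. 122–123; §4.9 p. 55] -/
theorem tendsto_archWeylRatio_comp_of_fst_eq_smul_one {e : mixedEmbedding.mixedSpace L}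
    (h0 : (((γc x₀).1.1 : GL (Fin 2) (mixedEmbedding.mixedSpace L)) : Matrix (Fin 2) (Fin 2) (mixedEmbedding.mixedSpace L)) =
      e • (1 : Matrix (Fin 2) (Fin 2) (mixedEmbedding.mixedSpace L))) :
    Tendsto (fun x => archWeylRatio L (γc x).1) (𝓝 x₀)
      (𝓝 (∏ w : {w : InfinitePlace L // IsComplex w}, ‖UnitaryGroup.evalC L w (archGammaTwo L (γc x₀).1 - e)‖ ^ 2)) := by
  rw [← archWeylRatio_of_fst_eq_smul_one L (γc x₀).1 h0]
  exact (continuousAt_archWeylRatio_comp L H' γc hc).tendsto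

include hc in
/-- **`τ_∞(γ_H(x)) → μ_∞(u)·μ_∞(−(u − e)²e⁻²)⁻¹`** as `x → x₀` when `g(x₀) = e·1₂` and the pair is `(G,H)`-regular there. [cite: Rogawski1990, §8.2 p. 123; §4.9 p. 55] -/
theorem tendsto_archTau_comp_of_fst_eq_smul_one (μ : HeckeCharacter L) {e : mixedEmbedding.mixedSpace L}
    (h0 : (((γc x₀).1.1 : GL (Fin 2) (mixedEmbedding.mixedSpace L)) : Matrix (Fin 2) (Fin 2) (mixedEmbedding.mixedSpace L)) =
      e • (1 : Matrix (Fin 2) (Fin 2) (mixedEmbedding.mixedSpace L)))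
    (hu : IsUnit ((archCharpolyTwo L (γc x₀).1).eval (archGammaTwo L (γc x₀).1))) :
    Tendsto (fun x => archTau L (γc x).1 μ) (𝓝 x₀)
      (𝓝 (archHeckeValue L μ (archGammaTwo L (γc x₀).1) *
        (archHeckeValue L μ (-((archGammaTwo L (γc x₀).1 - e) ^ 2) * (e ^ 2)⁻¹))⁻¹)) := by
  rw [← archTau_of_fst_eq_smul_one L (γc x₀).1 h0 μ]
  exact (continuousAt_archTau_comp L H' γc hc μ hu).tendsto

include hc in
open scoped Classical in
/-- **`Δ″_∞(γ_H(x), γ′(x)) → μ_∞(u)·μ_∞(−(u−e)²e⁻²)⁻¹ · Π_w ‖σ_w(u − e)‖² · Π_w κ_w(x₀)`** as `x → x₀` along a matching family with scalar `H`-block at `x₀`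
(`c`-hermitian anisotropic `H′`, `(G,H)`-regular at `x₀`): the transfer factor has a finite NON-ZERO limit at print's `γ₀` — the `|2 sin ψ|` of p. 123 is `D_H`, outside `Δ`.
[cite: Rogawski1990, §8.2 pp. 122–123; §14.6 p. 242] -/
theorem tendsto_archExplicitDelta_comp_of_fst_eq_smul_one (μ : HeckeCharacter L) (hherm : (H'.map (cmConjRingHom L)).transpose = H')
    (hanis : ∀ x : Fin 3 → L, hermForm (cmConjRingHom L) H' x x = 0 → x = 0) (hm : ∀ x, IsArchNormPair L H' (γc x).1 (γc x).2)
    {e : mixedEmbedding.mixedSpace L}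
    (h0 : (((γc x₀).1.1 : GL (Fin 2) (mixedEmbedding.mixedSpace L)) : Matrix (Fin 2) (Fin 2) (mixedEmbedding.mixedSpace L)) =
      e • (1 : Matrix (Fin 2) (Fin 2) (mixedEmbedding.mixedSpace L)))
    (hu : IsUnit ((archCharpolyTwo L (γc x₀).1).eval (archGammaTwo L (γc x₀).1))) :
    Tendsto (fun x => archExplicitDelta L H' (γc x).1 μ (γc x).2) (𝓝 x₀)
      (𝓝 (archHeckeValue L μ (archGammaTwo L (γc x₀).1) *
            (archHeckeValue L μ (-((archGammaTwo L (γc x₀).1 - e) ^ 2) * (e ^ 2)⁻¹))⁻¹ *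
          ((∏ w : {w : InfinitePlace L // IsComplex w}, ‖UnitaryGroup.evalC L w (archGammaTwo L (γc x₀).1 - e)‖ ^ 2 : ℝ) : ℂ) *
          ((∏ w : {w : InfinitePlace L // IsComplex w}, archKappaAt L H' (γc x₀).1 w (γc x₀).2 : ℤ) : ℂ))) := by
  rw [← archExplicitDelta_of_fst_eq_smul_one L (γc x₀).1 h0 H' μ (hm x₀)]
  exact (continuousAt_archExplicitDelta_comp_of_isUnit_eval L H' γc hc μ hherm hanis hm hu).tendsto

end Literature.NumberTheory.Rogawski1990

end
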